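import Literature.Topology.FourManifolds.ProductNeighborhoodNormalForm
import HarnessLib

/-!
# Slice charts in arbitrary codimension: the smooth structure on a slice subset

Topic `Literature/Topology/FourManifolds` (the codimension-`b` version of `SliceCharts.lean`,
which treats codimension one with the last coordinate split off by `Literature.snocEquiv`; here the
last `b` coordinates are split off by the tree's `Literature.Topology.FourManifolds.appendCLE hab : ℝᵃ × ℝᵇ ≅ ℝᴺ`,
`a + b = N`, of `ProductNeighborhoodNormalForm.lean`.  Consumer: regular fibres `f⁻¹(c)` of
smooth maps `f : M → ℝᵇ` at interior points, `RegularFibre.lean`, fed by the straightening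
charts of `SubmersionStraightening.lean`; fact seat
`provefact-Literature.Geometry.Symplectic.Oba2016_s-add47373d4`, fibres of Lefschetz fibrations
over the disc).

Let `M` be a `C^∞` manifold modelled on a model with corners `I` on `ℝᴺ` and `S ⊆ M`.  A
*family of slice charts of codimension `b`* for `S` (`SliceChartFamilyCodim I hab S`) assigns to
every `p ∈ S` a chart `ψₚ` of the maximal `C^∞` atlas of `M` around `p`, valued in the interior
of the model, in which `S` is the slice `{last b coordinates = 0}`:
`q ∈ S ↔ ((appendCLE hab)⁻¹ (I (ψₚ q))).2 = 0` for `q` in the domain of `ψₚ`.  Then — Lee,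
*Introduction to Smooth Manifolds* (2013), Thm. 5.8 (local `k`-slice criterion), with Thm. 5.11
for the charts; Hirsch, *Differential Topology* (1976), Ch. 1 §2 (submanifold charts) — `S`
with the subspace topology and the charts `π_a ∘ ψₚ|S` (keep the first `a` coordinates) is a
smooth `a`-manifold without boundary (`Ψ.chartedSpace`, `Ψ.isManifold`, model `𝓡 a`) and the
inclusion `S ↪ M` is a smooth embedding (`Ψ.isSmoothEmbedding_subtype_val`; in the charts it
reads `u ↦ appendCLE hab (u, 0)`, Mathlib's normal form `Manifold.IsImmersionAtOfComplement`
with complement `ℝᵇ`).  The port follows `SliceCharts.lean` line by line; as there, the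
charted-space structure depends on the data `Ψ` and is a reducible `def` bound by `letI` in the
statements.

## References

* J. M. Lee, *Introduction to Smooth Manifolds*, 2nd ed., GTM 218 (2013), Thm. 5.8, Thm. 5.11.
  [LeeSmoothManifolds2013]
* M. W. Hirsch, *Differential Topology*, GTM 33 (1976), Ch. 1 §2 (p. 14), §3 Thm. 3.2.
  [HirschDT1976]
-/

open scoped Manifold ContDiff Topology
open Set Function

noncomputable section

namespace Literature.Topology.FourManifolds

universe u

/-! ### The splitting `ℝᵃ × ℝᵇ ≅ ℝᴺ`: complements to `appendCLE` -/

section Append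

variable {a b N : ℕ} (hab : a + b = N)

/-- A vector whose last `b` coordinates vanish is recovered from its first `a` coordinates.
[folklore] -/
theorem appendCLE_fst_zero_of_snd_eq_zero {y : EuclideanSpace ℝ (Fin N)}
    (hy : ((appendCLE hab).symm y).2 = 0) :
    appendCLE hab (((appendCLE hab).symm y).1, 0) = y := by
  conv_rhs => rw [← (appendCLE hab).apply_symm_apply y]
  congr 1
  exact Prod.ext rfl (by rw [hy])

/-- The first `a` coordinates of `appendCLE hab (u, v)` form `u`. [folklore] -/
@[simp]
theorem appendCLE_symm_apply_fst_appendCLE (u : EuclideanSpace ℝ (Fin a)) (v : EuclideanSpace ℝ (Fin b)) :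
    ((appendCLE hab).symm (appendCLE hab (u, v))).1 = u := by
  rw [ContinuousLinearEquiv.symm_apply_apply]

/-- The last `b` coordinates of `appendCLE hab (u, v)` form `v`. [folklore] -/
@[simp]
theorem appendCLE_symm_apply_snd_appendCLE (u : EuclideanSpace ℝ (Fin a)) (v : EuclideanSpace ℝ (Fin b)) :
    ((appendCLE hab).symm (appendCLE hab (u, v))).2 = v := by
  rw [ContinuousLinearEquiv.symm_apply_apply]

/-- `u ↦ appendCLE hab (u, 0)` is continuous. [folklore] -/
theorem continuous_appendCLE_zero : Continuous fun u : EuclideanSpace ℝ (Fin a) => appendCLE hab (u, 0) :=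
  (appendCLE hab).continuous.comp (continuous_id.prodMk continuous_const)

/-- `u ↦ appendCLE hab (u, 0)` is `C^∞`. [folklore] -/
theorem contDiff_appendCLE_zero : ContDiff ℝ ∞ fun u : EuclideanSpace ℝ (Fin a) => appendCLE hab (u, 0) :=
  (appendCLE hab).contDiff.comp (contDiff_id.prodMk contDiff_const)

/-- `y ↦ ((appendCLE hab)⁻¹ y).1` is `C^∞`. [folklore] -/
theorem contDiff_appendCLE_symm_fst :
    ContDiff ℝ ∞ fun y : EuclideanSpace ℝ (Fin N) => ((appendCLE hab).symm y).1 :=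
  contDiff_fst.comp (appendCLE hab).symm.contDiff

end Append

/-! ### Families of slice charts of codimension `b` and the manifold structure on the slice -/

section Slice

variable {a b N : ℕ} {H : Type*} [TopologicalSpace H]
  (I : ModelWithCorners ℝ (EuclideanSpace ℝ (Fin N)) H) (hab : a + b = N)
  {M : Type u} [TopologicalSpace M] [ChartedSpace H M]

/-- A *family of slice charts of codimension `b`* for a subset `S` of a `C^∞` manifold `M`
modelled on a model with corners `I` on `ℝᴺ`, `a + b = N`: for every `p ∈ S` a chart `chart p`
of the maximal `C^∞` atlas of `M` with `p` in its source, valued in the interior of the model,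
in which `S` is the slice `{last b coordinates = 0}`:
`q ∈ S ↔ ((appendCLE hab)⁻¹ (I (chart p q))).2 = 0` for `q` in the source (Lee 2013, Thm. 5.8,
"local `k`-slice condition" with `k = a`; Hirsch 1976, Ch. 1 §2, submanifold charts).
[cite: LeeSmoothManifolds2013, Thm. 5.8] [cite: HirschDT1976, Ch. 1 §2, p. 14] -/
structure SliceChartFamilyCodim (S : Set M) where
  /-- The slice chart of `M` at `p ∈ S`. -/
  chart : S → OpenPartialHomeomorph M H
  /-- Slice charts are compatible with the smooth structure of `M`. -/
  mem_maximalAtlas : ∀ p, chart p ∈ IsManifold.maximalAtlas I ∞ M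
  /-- `p` lies in the source of its slice chart. -/
  mem_source : ∀ p, p.1 ∈ (chart p).source
  /-- In a slice chart, `S` is the slice `{last b coordinates = 0}`. -/
  mem_iff : ∀ p, ∀ q ∈ (chart p).source, q ∈ S ↔ ((appendCLE hab).symm (I (chart p q))).2 = 0
  /-- Slice charts take values in the interior of the model. -/
  mem_interior : ∀ p, ∀ q ∈ (chart p).source, I (chart p q) ∈ interior (range I)

namespace SliceChartFamilyCodim

variable {I hab} {S : Set M} (Ψ : SliceChartFamilyCodim I hab S)

/-- On `S`, a slice chart is determined by its first `a` coordinates. [folklore] -/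
theorem appendCLE_fst_chart (p : S) {q : M} (hq : q ∈ (Ψ.chart p).source) (hqS : q ∈ S) :
    appendCLE hab (((appendCLE hab).symm (I (Ψ.chart p q))).1, 0) = I (Ψ.chart p q) :=
  appendCLE_fst_zero_of_snd_eq_zero hab ((Ψ.mem_iff p q hq).1 hqS)

/-- A slice chart pulls the slice `{last b coordinates = 0}` (within the interior of the model
and the target) back into `S`. [folklore] -/
theorem symm_mem (p : S) {u : EuclideanSpace ℝ (Fin a)} (hu : appendCLE hab (u, 0) ∈ interior (range I))
    (hu' : I.symm (appendCLE hab (u, 0)) ∈ (Ψ.chart p).target) :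
    (Ψ.chart p).symm (I.symm (appendCLE hab (u, 0))) ∈ S := by
  rw [Ψ.mem_iff p _ ((Ψ.chart p).map_target hu'), (Ψ.chart p).right_inv hu',
    I.right_inv (interior_subset hu), appendCLE_symm_apply_snd_appendCLE]

open Classical in
/-- The chart of `S` at `p ∈ S` induced by the slice chart `Ψ.chart p`: restrict to `S` and keep
the first `a` coordinates; the inverse is `u ↦ (Ψ.chart p)⁻¹ (I⁻¹ (u, 0))` on the target (and
the junk value `p` elsewhere). Lee 2013, proof of Thm. 5.8. [cite: LeeSmoothManifolds2013, Thm. 5.8] -/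
def levelChart (p : S) : OpenPartialHomeomorph S (EuclideanSpace ℝ (Fin a)) where
  source := Subtype.val ⁻¹' (Ψ.chart p).source
  target := {u | appendCLE hab (u, 0) ∈ interior (range I) ∧
    I.symm (appendCLE hab (u, 0)) ∈ (Ψ.chart p).target}
  toFun q := ((appendCLE hab).symm (I (Ψ.chart p q.1))).1
  invFun u :=
    if h : appendCLE hab (u, 0) ∈ interior (range I) ∧
        I.symm (appendCLE hab (u, 0)) ∈ (Ψ.chart p).target then
      ⟨(Ψ.chart p).symm (I.symm (appendCLE hab (u, 0))), Ψ.symm_mem p h.1 h.2⟩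
    else p
  map_source' q hq := by
    simp only [mem_preimage] at hq
    refine ⟨?_, ?_⟩ <;> rw [Ψ.appendCLE_fst_chart p hq q.2]
    · exact Ψ.mem_interior p _ hq
    · rw [I.left_inv]; exact (Ψ.chart p).map_source hq
  map_target' u hu := by
    have hu' : appendCLE hab (u, 0) ∈ interior (range I) ∧
        I.symm (appendCLE hab (u, 0)) ∈ (Ψ.chart p).target := hu
    simp only [hu', and_self, ↓reduceDIte, mem_preimage]
    exact (Ψ.chart p).map_target hu'.2
  left_inv' q hq := by
    simp only [mem_preimage] at hq
    have h1 := Ψ.appendCLE_fst_chart p hq q.2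
    have h2 : appendCLE hab (((appendCLE hab).symm (I (Ψ.chart p q.1))).1, 0) ∈ interior (range I) ∧
        I.symm (appendCLE hab (((appendCLE hab).symm (I (Ψ.chart p q.1))).1, 0)) ∈
          (Ψ.chart p).target := by
      rw [h1, I.left_inv]
      exact ⟨Ψ.mem_interior p _ hq, (Ψ.chart p).map_source hq⟩
    simp only [h2, and_self, ↓reduceDIte]
    ext1
    simp only [h1]
    rw [I.left_inv, (Ψ.chart p).left_inv hq]
  right_inv' u hu := by
    have hu' : appendCLE hab (u, 0) ∈ interior (range I) ∧
        I.symm (appendCLE hab (u, 0)) ∈ (Ψ.chart p).target := hu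
    simp only [hu', and_self, ↓reduceDIte]
    rw [(Ψ.chart p).right_inv hu'.2, I.right_inv (interior_subset hu'.1),
      appendCLE_symm_apply_fst_appendCLE]
  open_source := (Ψ.chart p).open_source.preimage continuous_subtype_val
  open_target :=
    (isOpen_interior.preimage (continuous_appendCLE_zero hab)).inter
      ((Ψ.chart p).open_target.preimage (I.continuous_symm.comp (continuous_appendCLE_zero hab)))
  continuousOn_toFun := by
    refine (contDiff_appendCLE_symm_fst hab).continuous.comp_continuousOn
      (I.continuous.comp_continuousOn ?_)
    exact (Ψ.chart p).continuousOn.comp continuous_subtype_val.continuousOn fun q hq => hq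
  continuousOn_invFun := by
    rw [Topology.IsInducing.subtypeVal.continuousOn_iff]
    refine ContinuousOn.congr
      (f := fun u => (Ψ.chart p).symm (I.symm (appendCLE hab (u, 0)))) ?_ ?_
    · exact (Ψ.chart p).continuousOn_symm.comp
        (I.continuous_symm.comp (continuous_appendCLE_zero hab)).continuousOn fun u hu => hu.2
    · intro u hu
      have hu' : appendCLE hab (u, 0) ∈ interior (range I) ∧
          I.symm (appendCLE hab (u, 0)) ∈ (Ψ.chart p).target := hu
      simp [hu']

/-- `Ψ.levelChart p` is "keep the first `a` coordinates of `I ∘ Ψ.chart p`" (definitional).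
[folklore] -/
@[simp]
theorem levelChart_apply (p q : S) :
    Ψ.levelChart p q = ((appendCLE hab).symm (I (Ψ.chart p q.1))).1 := rfl

/-- The target of `Ψ.levelChart p` (definitional). [folklore] -/
theorem mem_levelChart_target {p : S} {u : EuclideanSpace ℝ (Fin a)} : u ∈ (Ψ.levelChart p).target ↔
    appendCLE hab (u, 0) ∈ interior (range I) ∧
      I.symm (appendCLE hab (u, 0)) ∈ (Ψ.chart p).target :=
  Iff.rfl

/-- On its target, the inverse of `Ψ.levelChart p` is `u ↦ (Ψ.chart p)⁻¹ (I⁻¹ (u, 0))`.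
[folklore] -/
theorem coe_levelChart_symm_of_mem {p : S} {u : EuclideanSpace ℝ (Fin a)} (hu : u ∈ (Ψ.levelChart p).target) :
    ((Ψ.levelChart p).symm u).val = (Ψ.chart p).symm (I.symm (appendCLE hab (u, 0))) := by
  have hu' : appendCLE hab (u, 0) ∈ interior (range I) ∧
      I.symm (appendCLE hab (u, 0)) ∈ (Ψ.chart p).target := hu
  have : (Ψ.levelChart p).symm u = ⟨_, Ψ.symm_mem p hu'.1 hu'.2⟩ := dif_pos hu'
  rw [this]

/-- On `S`, the slice chart is recovered from the level chart:
`I (Ψ.chart p q) = appendCLE hab (Ψ.levelChart p q, 0)`. [folklore] -/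
theorem appendCLE_levelChart {p q : S} (hq : q ∈ (Ψ.levelChart p).source) :
    appendCLE hab (Ψ.levelChart p q, 0) = I (Ψ.chart p q.1) :=
  Ψ.appendCLE_fst_chart p hq q.2

/-- **The smooth structure on a slice subset, charts**: the atlas of `S` induced by `Ψ`
consists of the level charts `Ψ.levelChart p`, `p ∈ S` (a `def`: it depends on `Ψ`).
Lee 2013, Thm. 5.8. [cite: LeeSmoothManifolds2013, Thm. 5.8] -/
@[reducible]
def chartedSpace : ChartedSpace (EuclideanSpace ℝ (Fin a)) S where
  atlas := range Ψ.levelChart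
  chartAt := Ψ.levelChart
  mem_chart_source p := Ψ.mem_source p
  chart_mem_atlas p := mem_range_self p

/-- The atlas of `Ψ.chartedSpace` is the range of `Ψ.levelChart` (definitional). [folklore] -/
theorem atlas_eq : letI := Ψ.chartedSpace; atlas (H := EuclideanSpace ℝ (Fin a)) (M := S) = range Ψ.levelChart :=
  rfl

/-- The preferred chart of `Ψ.chartedSpace` at `p` is `Ψ.levelChart p` (definitional).
[folklore] -/
theorem chartAt_eq (p : S) :
    letI := Ψ.chartedSpace; chartAt (H := EuclideanSpace ℝ (Fin a)) p = Ψ.levelChart p :=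
  rfl

/-- **The smooth structure on a slice subset, compatibility**: the level charts of a family of
slice charts form a `C^∞` atlas (the transition map is `u ↦ π_a (τ (u, 0))` for the extended
transition map `τ` of `M` between the slice charts, smooth as slice charts lie in the maximal
atlas). Lee 2013, Thm. 5.8. [cite: LeeSmoothManifolds2013, Thm. 5.8] -/
theorem isManifold : letI := Ψ.chartedSpace; IsManifold (𝓡 a) ∞ S := by
  letI := Ψ.chartedSpace
  apply isManifold_of_contDiffOn
  rintro e e' ⟨p, rfl⟩ ⟨p', rfl⟩
  have key : ContDiffOn ℝ ∞
      (fun u : EuclideanSpace ℝ (Fin a) => ((appendCLE hab).symm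
        (I.extendCoordChange (Ψ.chart p) (Ψ.chart p') (appendCLE hab (u, 0)))).1)
      ((Ψ.levelChart p).target ∩ (Ψ.levelChart p).symm ⁻¹' (Ψ.levelChart p').source) := by
    refine (contDiff_appendCLE_symm_fst hab).comp_contDiffOn (ContDiffOn.comp
      (I.contDiffOn_extendCoordChange (Ψ.mem_maximalAtlas p) (Ψ.mem_maximalAtlas p'))
      (contDiff_appendCLE_zero hab).contDiffOn ?_)
    rintro u ⟨hu1, hu2⟩
    rw [ModelWithCorners.extendCoordChange_source]
    refine ⟨I.symm (appendCLE hab (u, 0)), ⟨hu1.2, ?_⟩, I.right_inv (interior_subset hu1.1)⟩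
    change ((Ψ.levelChart p).symm u).val ∈ (Ψ.chart p').source at hu2
    rwa [Ψ.coe_levelChart_symm_of_mem hu1] at hu2
  simp only [modelWithCornersSelf_coe, modelWithCornersSelf_coe_symm, preimage_id, range_id,
    inter_univ, Function.comp_id, Function.id_comp]
  rw [OpenPartialHomeomorph.coe_trans, OpenPartialHomeomorph.trans_source,
    OpenPartialHomeomorph.symm_source]
  refine key.congr ?_
  rintro u ⟨hu1, hu2⟩
  simp only [comp_apply, levelChart_apply, PartialEquiv.coe_trans,
    OpenPartialHomeomorph.extend_coe, OpenPartialHomeomorph.extend_coe_symm,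
    Ψ.coe_levelChart_symm_of_mem hu1]

/-- **The inclusion of a slice subset is a smooth immersion**: in the charts `Ψ.levelChart p`
and `Ψ.chart p` the inclusion `S → M` reads `u ↦ appendCLE hab (u, 0)`, Mathlib's normal form
`Manifold.IsImmersionAtOfComplement` with complement `ℝᵇ`. Lee 2013, Thm. 5.8.
[cite: LeeSmoothManifolds2013, Thm. 5.8] -/
theorem isImmersion_subtype_val [IsManifold I ∞ M] :
    letI := Ψ.chartedSpace; Manifold.IsImmersion (𝓡 a) I ∞ (Subtype.val : S → M) := by
  letI := Ψ.chartedSpace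
  haveI := Ψ.isManifold
  refine Manifold.IsImmersionOfComplement.isImmersion (F := EuclideanSpace ℝ (Fin b)) fun p => ?_
  refine Manifold.IsImmersionAtOfComplement.mk_of_continuousAt
    continuous_subtype_val.continuousAt (appendCLE hab) (Ψ.levelChart p) (Ψ.chart p)
    (Ψ.mem_source p) (Ψ.mem_source p) (IsManifold.chart_mem_maximalAtlas p)
    (Ψ.mem_maximalAtlas p) ?_
  intro u hu
  rw [OpenPartialHomeomorph.extend_target, modelWithCornersSelf_coe_symm, modelWithCornersSelf_coe,
    range_id, inter_univ, preimage_id] at hu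
  have hu' : u ∈ (Ψ.levelChart p).target := hu
  simp only [comp_apply, OpenPartialHomeomorph.extend_coe, OpenPartialHomeomorph.extend_coe_symm,
    modelWithCornersSelf_coe_symm, id_eq]
  rw [Ψ.coe_levelChart_symm_of_mem hu', (Ψ.chart p).right_inv hu'.2,
    I.right_inv (interior_subset hu'.1)]

/-- **The inclusion of a slice subset is a smooth embedding**. Lee 2013, Thm. 5.8.
[cite: LeeSmoothManifolds2013, Thm. 5.8] -/
theorem isSmoothEmbedding_subtype_val [IsManifold I ∞ M] :
    letI := Ψ.chartedSpace; Manifold.IsSmoothEmbedding (𝓡 a) I ∞ (Subtype.val : S → M) := by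
  letI := Ψ.chartedSpace
  exact ⟨Ψ.isImmersion_subtype_val, Topology.IsEmbedding.subtypeVal⟩

/-- The inclusion of a slice subset is smooth. [cite: LeeSmoothManifolds2013, Thm. 5.8] -/
theorem contMDiff_subtype_val [IsManifold I ∞ M] :
    letI := Ψ.chartedSpace; ContMDiff (𝓡 a) I ∞ (Subtype.val : S → M) := by
  letI := Ψ.chartedSpace
  exact (Ψ.isImmersion_subtype_val).contMDiff

end SliceChartFamilyCodim

end Slice

end Literature.Topology.FourManifolds

end
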